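import Literature.Probability.Percolation.InterfaceTraversalBound

/-!
# drefute gen-6 — `pertTrace ⊆ D` for a GENERAL family member (helper for STUB A
`stub_upperFence`, crux `SLESixFamiliesGiveCardy`, stmt-CriticalPhenomena-9654)

`InterfaceTraversalBound.pertTrace_subset_carrier` is stated for the canonical data
`dobrushinData Dm δ`; the fence argument runs the exploration of a family member `Λ δ`
(`ZdDiscretisationFamily`: `(Λ δ).Ω = Dm.carrier`, `(Λ δ).δ = δ`, arbitrary arcs).  Since
`IsInnerFace` depends on `(Ω, δ)` only, the proof transfers verbatim (gen-5 §2 claimed it; this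
file checks it).  Positive helper, NOT a refutation.  `lean check`: rc 0, 0 sorries, 0 warnings.
-/

noncomputable section

open Set Metric Complex
open scoped Pointwise

namespace Literature.Probability.Percolation

open LatticeModels LatticeModels.IsMedialExploration

namespace DrefuteG6

variable {Dm : RandomPlanarGeometry.DobrushinDomain} {δ : ℝ} {ω : BondConfig (Site 2)} {a : MedialVertex}
  {l : List MedialVertex}

/-- Inner faces depend only on the domain and the mesh. [folklore] -/
theorem isInnerFace_iff_of_eq {D D' : DiscreteDobrushin} (hΩ : D.Ω = D'.Ω) (hδ : D.δ = D'.δ)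
    (f : Site 2) : D.IsInnerFace f ↔ D'.IsInnerFace f := by
  unfold DiscreteDobrushin.IsInnerFace
  rw [hΩ, hδ]

/-- **The perturbed polygon of the exploration of ANY Dobrushin data on `(Dm.carrier, δ)` lies in
the domain** (transfer of `pertTrace_subset_carrier` from `dobrushinData Dm δ` to data with the
same domain and mesh but arbitrary arcs, e.g. a member `Λ δ` of a `ZdDiscretisationFamily`).
[cite: Smirnov2001, §2] -/
theorem pertTrace_subset_carrier_of_eq {D : DiscreteDobrushin} (hΩ : D.Ω = Dm.carrier)
    (hδD : D.δ = δ) (hδ : 0 < δ) (hexp : IsMedialExploration D ω (a :: l)) :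
    hexp.pertTrace ⊆ Dm.carrier := by
  have hface : ∀ {f : Site 2}, D.IsInnerFace f → (dobrushinData Dm δ).IsInnerFace f := fun hf =>
    (isInnerFace_iff_of_eq (D := D) (D' := dobrushinData Dm δ) (by simpa using hΩ)
      (by simpa using hδD) _).1 hf
  intro z hz
  have hδ' : 0 < D.δ := by rw [hδD]; exact hδ
  rcases hexp.mem_pertTrace_iff.1 hz with ⟨i, hi, hzi⟩ | ⟨i, ⟨hi1, hi⟩, hzi⟩
  · rw [hexp.dartPiece_eq, Set.mem_smul_set_iff_inv_smul_mem₀ hδ'.ne', hδD] at hzi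
    exact mem_carrier_of_mem_openSq hδ (hface (hexp.isInnerFace hi))
      (dartSeg_subset_openSq (hexp.isCorner hi) hzi)
  · rcases hexp.connPiece_cases hi1 hi hδ' hzi with
      ⟨I, J, hJI, -, -, hcol, hside, -, hshape⟩ | ⟨I, J, hJI, -, -, -, -, hshape, -, -⟩
    · rw [hδD] at hshape
      rcases hside with ⟨h1, h2⟩ | ⟨h1, h2⟩
      · exact mem_carrier_of_vConnShape hδ (hface (hexp.isInnerFace (by omega)))
          (hface (hexp.isInnerFace hi)) hJI rfl hcol.symm h1 h2 hshape
      · exact mem_carrier_of_vConnShape hδ (hface (hexp.isInnerFace hi))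
          (hface (hexp.isInnerFace (by omega))) hJI hcol.symm rfl h2 h1 hshape
    · refine mem_carrier_of_mem_openSq hδ (hface (hexp.isInnerFace hi)) fun k => ?_
      obtain ⟨-, ⟨h1, h2⟩, h3⟩ := hshape
      rw [hδD] at h1 h2 h3
      rcases fin_two_cases_of_ne hJI k with rfl | rfl
      · constructor <;> linarith
      · rcases h3 with h | h <;> rw [h] <;> constructor <;> linarith

/-- The perturbed polygon misses the boundary curve (general data). [cite: Smirnov2001, §2] -/
theorem pertTrace_disjoint_frontier_of_eq {D : DiscreteDobrushin} (hΩ : D.Ω = Dm.carrier)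
    (hδD : D.δ = δ) (hδ : 0 < δ) (hexp : IsMedialExploration D ω (a :: l)) :
    Disjoint hexp.pertTrace (frontier Dm.carrier) :=
  Set.disjoint_left.2 fun _ hz hz' =>
    Set.disjoint_left.1 Dm.disjoint_carrier_frontier (pertTrace_subset_carrier_of_eq hΩ hδD hδ hexp hz) hz'

end DrefuteG6

end Literature.Probability.Percolation
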